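import Literature.AnabelianGeometry.SemiGraphs.TemperedPiPresentation
import Literature.AnabelianGeometry.SemiGraphs.SubgroupPresentationMapTo
import Literature.AnabelianGeometry.SemiGraphs.TemperedPiTrees
import HarnessLib

/-!
# The trees `𝒢_{∞,n}` of the Galois tower are coset semi-graphs of `π₁^temp(𝒢)` ([SemiAnbd] Thm 3.7 (iii) p. 41)

Mochizuki, *Semi-graphs of anabelioids*, Publ. RIMS **42** (2006), §3, proof of Thm. 3.7 (iii) p. 41
("`H ⊆ π₁^temp(𝒢)` … acts continuously on the semi-graph `𝒢_{∞,i}` … the action of `H` is over `𝒢`";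
"natural maps `V_i → V_j`") [cite: MochizukiSemiAnbd2006, Thm 3.7(iii) p.41].

DICTIONARY, part 4 (cell row T54-B, tower third, file T3d-1; plan/GAP-LEDGER.md G-w4d053-1): for
abc-iut-L3-t9's Galois tower `D` with compatible point sequences `T` over every vertex and reference
branches `R`, the isomorphism of semi-graphs
`D.treeCosetIso T R n : (D.piPresentation T R).cosetGraph (ker ρ_n) ≅ D.tree n`
(ρ_n = `π₁^temp(𝒢) ↠ Gal(𝒢_{∞,n}/𝒢)`), assembled from `cosetGraphIsoTo` along `ρ_n` onto the level
presentation (part 3's `map_projAut_piPresentation`), `cosetGraphIsoOrbitGraph` (part 2) and abc-iut-L3-t6's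
`treeIso`.  PROVED: it lies OVER `𝔾` (`treeCosetIso_hom_comp_treeProj`), it INTERTWINES the deck action
with t6's `treeAct` (`deckAct_comp_treeCosetIso`), and it is COMPATIBLE WITH THE TRANSITIONS
(`treeCosetIso_trans`: the transition `cosetGraphTrans` of coset semi-graphs corresponds to t6's
`treeStep`).  Nothing here bears on [IUTchIII] Cor. 3.12.
-/

namespace Literature.AnabelianGeometry.SemiGraphs

namespace ProfiniteSemiGraph

namespace GaloisLevelData

open CategoryTheory

universe u

variable {𝒢 : ProfiniteSemiGraph.{u}} (D : GaloisLevelData 𝒢) (h𝒢 : 𝒢.IsCountable)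
  (T : ∀ w : 𝒢.graph.Vertex, D.PointSeq h𝒢 w) (R : SemiGraph.RefBranches 𝒢.graph)

/-! ### The comparison morphism at level `n` -/

/-- The image of the kernel of `ρ_n` under `ρ_n` is trivial. [cite: MochizukiSemiAnbd2006, Prop 3.6 p.38] -/
theorem map_ker_projAut (n : ℕ) : ((D.projAut h𝒢 n).ker).map (D.projAut h𝒢 n) = ⊥ :=
  (Subgroup.map_eq_bot_iff _).mpr le_rfl

/-- `ρ_n` carries the vertex subgroups of the presentation onto those of the level presentation.
[cite: MochizukiSemiAnbd2006, Thm 3.7(iii) p.41] -/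
theorem map_projAut_H (n : ℕ) (w : 𝒢.graph.Vertex) :
    ((D.piPresentation h𝒢 T R).H w).map (D.projAut h𝒢 n) = (D.levelPres h𝒢 T R n).H w :=
  congrArg (fun Q : SemiGraph.SubgroupPresentation 𝒢.graph (Aut (D.cover h𝒢 n)) => Q.H w)
    (D.map_projAut_piPresentation h𝒢 T R n)

/-- … the edge subgroups … [cite: MochizukiSemiAnbd2006, Thm 3.7(iii) p.41] -/
theorem map_projAut_M (n : ℕ) (e : 𝒢.graph.Edge) :
    ((D.piPresentation h𝒢 T R).M e).map (D.projAut h𝒢 n) = (D.levelPres h𝒢 T R n).M e :=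
  congrArg (fun Q : SemiGraph.SubgroupPresentation 𝒢.graph (Aut (D.cover h𝒢 n)) => Q.M e)
    (D.map_projAut_piPresentation h𝒢 T R n)

/-- … and the branch elements. [cite: MochizukiSemiAnbd2006, Thm 3.7(iii) p.41] -/
theorem projAut_s (n : ℕ) (b : 𝒢.graph.Branch) :
    D.projAut h𝒢 n ((D.piPresentation h𝒢 T R).s b) = (D.levelPres h𝒢 T R n).s b :=
  D.projAut_brEltPi h𝒢 T R n b

/-- The comparison morphism `(piPresentation).cosetGraph (ker ρ_n) ⟶ (levelPres n).cosetGraph ⊥`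
(`y ↦ ρ_n y`). [cite: MochizukiSemiAnbd2006, Thm 3.7(iii) p.41] -/
noncomputable def treeCosetHom (n : ℕ) :
    (D.piPresentation h𝒢 T R).cosetGraph (D.projAut h𝒢 n).ker ⟶ (D.levelPres h𝒢 T R n).cosetGraph ⊥ :=
  SemiGraph.SubgroupPresentation.cosetGraphMapTo _ _ (D.projAut h𝒢 n) _ ⊥ (D.map_projAut_H h𝒢 T R n)
    (D.map_projAut_M h𝒢 T R n) (D.projAut_s h𝒢 T R n) (D.map_ker_projAut h𝒢 n)

/-- **The tree `𝒢_{∞,n}` is the coset semi-graph of `π₁^temp(𝒢)` at the level `ker ρ_n`.**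
[cite: MochizukiSemiAnbd2006, Thm 3.7(iii) p.41] -/
noncomputable def treeCosetIso (n : ℕ) :
    (D.piPresentation h𝒢 T R).cosetGraph (D.projAut h𝒢 n).ker ≅ D.tree n :=
  SemiGraph.SubgroupPresentation.cosetGraphIsoTo _ _ (D.projAut h𝒢 n) _ ⊥ (D.map_projAut_H h𝒢 T R n)
      (D.map_projAut_M h𝒢 T R n) (D.projAut_s h𝒢 T R n) (D.map_ker_projAut h𝒢 n)
      (D.projAut_surjective h𝒢 n) le_rfl ≪≫
    (D.ptData h𝒢 T R n).cosetGraphIsoOrbitGraph (D.cover_sameComponent h𝒢 n) (D.cover_htrans h𝒢 n) ≪≫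
    D.treeIso h𝒢 n

/-- The `hom` of the identification. [cite: MochizukiSemiAnbd2006, Thm 3.7(iii) p.41] -/
theorem treeCosetIso_hom (n : ℕ) :
    (D.treeCosetIso h𝒢 T R n).hom = D.treeCosetHom h𝒢 T R n ≫
      (D.ptData h𝒢 T R n).toOrbitGraph (D.cover_sameComponent h𝒢 n) (D.cover_htrans h𝒢 n) ≫
        (D.treeIso h𝒢 n).hom := rfl

/-- The identification `treeIso` of abc-iut-L3-t6 is over `𝔾`. [cite: MochizukiSemiAnbd2006, Thm 3.7(iii) p.41] -/
theorem treeIso_hom_comp_treeProj (n : ℕ) :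
    (D.treeIso h𝒢 n).hom ≫ D.treeProj n = (D.cover h𝒢 n).orbitGraphProj :=
  (D.S n).univCoverOverToUnivCover_comp_proj (Sum.inl (D.W n)) h𝒢

/-- **The identification is over `𝔾`.** [cite: MochizukiSemiAnbd2006, Thm 3.7(iii) p.41] -/
theorem treeCosetIso_hom_comp_treeProj (n : ℕ) :
    (D.treeCosetIso h𝒢 T R n).hom ≫ D.treeProj n =
      (D.piPresentation h𝒢 T R).cosetGraphProj (D.projAut h𝒢 n).ker := by
  rw [treeCosetIso_hom, Category.assoc, Category.assoc, D.treeIso_hom_comp_treeProj h𝒢 n,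
    CovObj.PtData.toOrbitGraph_comp_proj]
  exact SemiGraph.SubgroupPresentation.cosetGraphMapTo_comp_proj _ _ _ _ _ _ _ _ _

/-- The identification `treeIso` intertwines `orbitGraphMap q` with `galTreeAct n q` (abc-iut-L3-t6's
`autUnivCover` is conjugation by `treeIso`). [cite: MochizukiSemiAnbd2006, Thm 3.7(iii) p.41] -/
theorem orbitGraphMap_comp_treeIso (n : ℕ) (q : D.Gal h𝒢 n) :
    CovObj.orbitGraphMap q.hom ≫ (D.treeIso h𝒢 n).hom = (D.treeIso h𝒢 n).hom ≫ (D.galTreeAct h𝒢 n q).hom := by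
  change _ = _ ≫ ((D.S n).autUnivCover (Sum.inl (D.W n)) h𝒢 q).hom
  rw [(D.S n).autUnivCover_hom (Sum.inl (D.W n)) h𝒢 q]
  change _ = (D.treeIso h𝒢 n).hom ≫ (D.treeIso h𝒢 n).inv ≫ _ ≫ (D.treeIso h𝒢 n).hom
  rw [Iso.hom_inv_id_assoc]
  rfl

/-- **The identification intertwines the deck action of `π₁^temp(𝒢)` on the coset semi-graph with its
action on the tree `𝒢_{∞,n}`.** [cite: MochizukiSemiAnbd2006, Thm 3.7(iii) p.41] -/
theorem deckAct_comp_treeCosetIso (n : ℕ) (g : D.temperedPi h𝒢) :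
    ((D.piPresentation h𝒢 T R).deckAct (D.projAut h𝒢 n).ker g).hom ≫ (D.treeCosetIso h𝒢 T R n).hom =
      (D.treeCosetIso h𝒢 T R n).hom ≫ (D.treeAct h𝒢 n g).hom := by
  rw [treeCosetIso_hom, ← Category.assoc]
  change (_ ≫ SemiGraph.SubgroupPresentation.cosetGraphMapTo _ _ _ _ _ _ _ _ _) ≫ _ = _
  rw [SemiGraph.SubgroupPresentation.deckAct_comp_cosetGraphMapTo, Category.assoc,
    ← Category.assoc (((D.levelPres h𝒢 T R n).deckAct ⊥ _).hom)]
  change _ ≫ ((((D.ptData h𝒢 T R n).ptPresentation _ _).deckAct ⊥ (D.projAut h𝒢 n g)).hom ≫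
    (D.ptData h𝒢 T R n).toOrbitGraph _ _) ≫ _ = _
  rw [CovObj.PtData.deckAct_comp_toOrbitGraph, Category.assoc, D.orbitGraphMap_comp_treeIso h𝒢 n]
  rfl

/-! ### Compatibility with the transitions of the tower -/

/-- `ker ρ_{n+1} ≤ ker ρ_n`. [cite: MochizukiSemiAnbd2006, Prop 3.6 p.38] -/
theorem ker_projAut_succ_le (n : ℕ) : (D.projAut h𝒢 (n + 1)).ker ≤ (D.projAut h𝒢 n).ker := by
  intro g hg
  rw [MonoidHom.mem_ker] at hg ⊢
  change D.proj h𝒢 n g = 1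
  rw [← D.step_proj h𝒢 n g]
  change D.stepAut h𝒢 n (D.projAut h𝒢 (n + 1) g) = 1
  rw [hg, map_one]

/-- The level transition maps carry base-point embeddings to base-point embeddings.
[cite: MochizukiSemiAnbd2006, Thm 3.7(i) p.40] -/
theorem stepAut_ptHom (n : ℕ) (w : 𝒢.graph.Vertex) (h : 𝒢.Gv w) :
    D.stepAut h𝒢 n ((D.cover h𝒢 (n + 1)).ptHom (D.cover_sameComponent h𝒢 (n + 1))
        (D.cover_htrans h𝒢 (n + 1)) ((T w).pt (n + 1)) h) =
      (D.cover h𝒢 n).ptHom (D.cover_sameComponent h𝒢 n) (D.cover_htrans h𝒢 n) ((T w).pt n) h := by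
  rw [D.ptHom_eq_gal h𝒢 T (n + 1) w h, D.ptHom_eq_gal h𝒢 T n w h]
  exact (T w).step_gal n h

/-- `step` carries the vertex subgroups of the level presentations to each other.
[cite: MochizukiSemiAnbd2006, Thm 3.7(iii) p.41] -/
theorem map_stepAut_H (n : ℕ) (w : 𝒢.graph.Vertex) :
    ((D.levelPres h𝒢 T R (n + 1)).H w).map (D.stepAut h𝒢 n) = (D.levelPres h𝒢 T R n).H w := by
  change (MonoidHom.range _).map _ = MonoidHom.range _
  rw [MonoidHom.map_range]
  exact congrArg MonoidHom.range (MonoidHom.ext fun h => D.stepAut_ptHom h𝒢 T n w h)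

/-- … the edge subgroups … [cite: MochizukiSemiAnbd2006, Thm 3.7(iii) p.41] -/
theorem map_stepAut_M (n : ℕ) (e : 𝒢.graph.Edge) :
    ((D.levelPres h𝒢 T R (n + 1)).M e).map (D.stepAut h𝒢 n) = (D.levelPres h𝒢 T R n).M e := by
  change (Subgroup.map _ _).map _ = Subgroup.map _ _
  rw [Subgroup.map_map]
  exact congrArg (fun φ => Subgroup.map φ _) (MonoidHom.ext fun h => D.stepAut_ptHom h𝒢 T n (R.ν e) h)

/-- The transition `(levelPres (n+1)).cosetGraph ⊥ ⟶ (levelPres n).cosetGraph ⊥` along `step`.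
[cite: MochizukiSemiAnbd2006, Thm 3.7(iii) p.41] -/
noncomputable def levelStepHom (n : ℕ) :
    (D.levelPres h𝒢 T R (n + 1)).cosetGraph ⊥ ⟶ (D.levelPres h𝒢 T R n).cosetGraph ⊥ :=
  SemiGraph.SubgroupPresentation.cosetGraphMapTo _ _ (D.stepAut h𝒢 n) ⊥ ⊥ (D.map_stepAut_H h𝒢 T R n)
    (D.map_stepAut_M h𝒢 T R n) (D.stepAut_brElt h𝒢 T R n) (Subgroup.map_bot _)

/-- The comparison morphisms commute with the transitions (`ρ_n = step ∘ ρ_{n+1}`).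
[cite: MochizukiSemiAnbd2006, Thm 3.7(iii) p.41] -/
theorem treeCosetHom_trans (n : ℕ) :
    (D.piPresentation h𝒢 T R).cosetGraphTrans (D.ker_projAut_succ_le h𝒢 n) ≫ D.treeCosetHom h𝒢 T R n =
      D.treeCosetHom h𝒢 T R (n + 1) ≫ D.levelStepHom h𝒢 T R n := by
  refine (D.piPresentation h𝒢 T R).hom_ext_mk _ _ _ (fun w y => ?_) (fun e y => ?_) (fun b y => ?_)
  · change (D.levelPres h𝒢 T R n).vMk ⊥ w (D.projAut h𝒢 n y) =
      (D.levelPres h𝒢 T R n).vMk ⊥ w (D.stepAut h𝒢 n (D.projAut h𝒢 (n + 1) y))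
    exact congrArg ((D.levelPres h𝒢 T R n).vMk ⊥ w) (D.step_proj h𝒢 n y).symm
  · change (D.levelPres h𝒢 T R n).eMk ⊥ e (D.projAut h𝒢 n y) =
      (D.levelPres h𝒢 T R n).eMk ⊥ e (D.stepAut h𝒢 n (D.projAut h𝒢 (n + 1) y))
    exact congrArg ((D.levelPres h𝒢 T R n).eMk ⊥ e) (D.step_proj h𝒢 n y).symm
  · change (D.levelPres h𝒢 T R n).bMk ⊥ b (D.projAut h𝒢 n y) =
      (D.levelPres h𝒢 T R n).bMk ⊥ b (D.stepAut h𝒢 n (D.projAut h𝒢 (n + 1) y))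
    exact congrArg ((D.levelPres h𝒢 T R n).bMk ⊥ b) (D.step_proj h𝒢 n y).symm

/-- `stepCover` commutes with endomorphisms through `step`, on edge fibres.
[cite: MochizukiSemiAnbd2006, Prop 3.6 p.38] -/
theorem stepCover_fE_aut (n : ℕ) (σ : Aut (D.cover h𝒢 (n + 1))) {e : 𝒢.graph.Edge}
    (z : ((D.cover h𝒢 (n + 1)).SE e).obj.V) :
    ((D.stepCover h𝒢 n).fE e).hom.hom ((σ.hom.fE e).hom.hom z) =
      ((D.stepAut h𝒢 n σ).hom.fE e).hom.hom (((D.stepCover h𝒢 n).fE e).hom.hom z) :=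
  congrArg (fun φ : D.cover h𝒢 (n + 1) ⟶ D.cover h𝒢 n => (φ.fE e).hom.hom z) (D.hom_comp_stepCover h𝒢 n σ)

/-- **The coset-to-orbit-graph morphisms commute with the covering maps of the tower.**
[cite: MochizukiSemiAnbd2006, Thm 3.7(iii) p.41] -/
theorem toOrbitGraph_stepCover (n : ℕ) :
    (D.ptData h𝒢 T R (n + 1)).toOrbitGraph (D.cover_sameComponent h𝒢 (n + 1)) (D.cover_htrans h𝒢 (n + 1)) ≫
        CovObj.orbitGraphMap (D.stepCover h𝒢 n) =
      D.levelStepHom h𝒢 T R n ≫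
        (D.ptData h𝒢 T R n).toOrbitGraph (D.cover_sameComponent h𝒢 n) (D.cover_htrans h𝒢 n) := by
  refine (D.levelPres h𝒢 T R (n + 1)).hom_ext_mk ⊥ _ _ (fun w y => ?_) (fun e y => ?_) (fun b y => ?_)
  · change CovObj.OVertex.map (D.stepCover h𝒢 n)
        (Quot.mk _ ⟨w, ((y⁻¹).hom.fV w).hom.hom ((T w).pt (n + 1))⟩) =
      Quot.mk _ ⟨w, (((D.stepAut h𝒢 n y)⁻¹).hom.fV w).hom.hom ((T w).pt n)⟩
    rw [CovObj.oVertexMap_mk, D.stepCover_apply_aut h𝒢 n, (T w).compat n, ← map_inv]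
    rfl
  · change CovObj.OEdge.map (D.stepCover h𝒢 n)
        (Quot.mk _ ⟨𝒢.graph.edgeOf (R.β e), ((y⁻¹).hom.fE _).hom.hom ((D.ptData h𝒢 T R (n + 1)).ePt e)⟩) =
      Quot.mk _ ⟨𝒢.graph.edgeOf (R.β e),
        (((D.stepAut h𝒢 n y)⁻¹).hom.fE _).hom.hom ((D.ptData h𝒢 T R n).ePt e)⟩
    change (Quot.mk (D.cover h𝒢 n).ERel ⟨𝒢.graph.edgeOf (R.β e), ((D.stepCover h𝒢 n).fE _).hom.hom
      (((y⁻¹).hom.fE _).hom.hom ((D.ptData h𝒢 T R (n + 1)).ePt e))⟩ : (D.cover h𝒢 n).OEdge) = _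
    have hε := D.stepCover_ePt h𝒢 T R n e
    change ((D.stepCover h𝒢 n).fE (𝒢.graph.edgeOf (R.β e))).hom.hom ((D.ptData h𝒢 T R (n + 1)).ePt e) =
      (D.ptData h𝒢 T R n).ePt e at hε
    rw [D.stepCover_fE_aut h𝒢 n, hε, ← map_inv]
  · refine Subtype.ext (Prod.ext rfl ?_)
    change CovObj.OEdge.map (D.stepCover h𝒢 n)
        (Quot.mk _ ⟨𝒢.graph.edgeOf (R.β (𝒢.graph.edgeOf b)),
          ((y⁻¹).hom.fE _).hom.hom ((D.ptData h𝒢 T R (n + 1)).ePt (𝒢.graph.edgeOf b))⟩) =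
      Quot.mk _ ⟨𝒢.graph.edgeOf (R.β (𝒢.graph.edgeOf b)),
        (((D.stepAut h𝒢 n y)⁻¹).hom.fE _).hom.hom ((D.ptData h𝒢 T R n).ePt (𝒢.graph.edgeOf b))⟩
    change (Quot.mk (D.cover h𝒢 n).ERel ⟨𝒢.graph.edgeOf (R.β (𝒢.graph.edgeOf b)),
      ((D.stepCover h𝒢 n).fE _).hom.hom (((y⁻¹).hom.fE _).hom.hom
        ((D.ptData h𝒢 T R (n + 1)).ePt (𝒢.graph.edgeOf b)))⟩ : (D.cover h𝒢 n).OEdge) = _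
    have hε := D.stepCover_ePt h𝒢 T R n (𝒢.graph.edgeOf b)
    change ((D.stepCover h𝒢 n).fE (𝒢.graph.edgeOf (R.β (𝒢.graph.edgeOf b)))).hom.hom
        ((D.ptData h𝒢 T R (n + 1)).ePt (𝒢.graph.edgeOf b)) = (D.ptData h𝒢 T R n).ePt (𝒢.graph.edgeOf b) at hε
    rw [D.stepCover_fE_aut h𝒢 n, hε, ← map_inv]

/-- **The identifications are compatible with the transitions**: the transition of coset semi-graphs
`cosetGraphTrans (ker ρ_{n+1} ≤ ker ρ_n)` corresponds to abc-iut-L3-t6's `treeStep n : 𝒢_{∞,n+1} → 𝒢_{∞,n}`.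
[cite: MochizukiSemiAnbd2006, Thm 3.7(iii) p.41] -/
theorem treeCosetIso_trans (n : ℕ) :
    (D.treeCosetIso h𝒢 T R (n + 1)).hom ≫ D.treeStep n =
      (D.piPresentation h𝒢 T R).cosetGraphTrans (D.ker_projAut_succ_le h𝒢 n) ≫
        (D.treeCosetIso h𝒢 T R n).hom := by
  rw [treeCosetIso_hom, treeCosetIso_hom, Category.assoc, Category.assoc,
    ← D.orbitGraphMap_stepCover h𝒢 n, ← Category.assoc (CovObj.PtData.toOrbitGraph _ _ _),
    D.toOrbitGraph_stepCover h𝒢 T R n, Category.assoc, ← Category.assoc (D.treeCosetHom h𝒢 T R (n + 1)),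
    ← D.treeCosetHom_trans h𝒢 T R n, Category.assoc]

end GaloisLevelData

end ProfiniteSemiGraph

end Literature.AnabelianGeometry.SemiGraphs
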